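import Literature.MathematicalPhysics.QuantumFieldTheory.Balaban1983to89.B9Thm37AllNormsRight

/-!
# `Balaban1983to89.B9Thm37AllNormsTwoSided` — [B9] Theorem 3.7 and Corollary 3.8 (pp. 408–410) for the TWO-SIDED
# members of (3.42)–(3.47) (∇_UG′∇*_U of (3.44)–(3.45), ‖h∇_UG′∇*_Uλ‖ of (3.46)₄): the series Σₙ EG′₀R′ⁿA over
# ARBITRARY block norms at the input of A and the output of E — sequel of `…B9Thm37AllNorms` / `…B9Thm37AllNormsRight`

T. Bałaban, *Propagators for lattice gauge theories in a background field*, Commun. Math. Phys. **99**, 389–434 (1985)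
[Balaban1985BackgroundPropagators] (cell paper B9; journal page = PDF page + 388); [4] = [Balaban1984PropagatorsII],
[3] = [Balaban1984PropagatorsI].

statement-level skeleton of published theorems with citation tags; proofs where landed; nothing here is a claim about the Yang–Mills mass gap

CITATION HEADER (lean-in-tree rule).  THE PRINTED LOCI are those certified in the headers of `…B9Thm37Sum` and
`…B9Thm37AllNorms`: Theorem 3.7 with (3.87)–(3.90) p. 409 [PDF 21], its proof and Corollary 3.8 (3.91)–(3.94) p. 410
[PDF 22] (*"The expansion is convergent in all norms appearing in the inequalities (3.42)–(3.47)"*; *"Similar estimates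
hold for the other norms"*), and the two-sided members among (3.42)–(3.47) pp. 397–398 [PDF 9–10]: (3.44)
*"|(∇_UG′(U)∇*_Uλ)(x)| ≤ (B′₀(ε)(L^{j′}η)^ε‖λ‖^{ξ′}_ε + B₀|λ|)e^{−δ₀d(y,y′)}"* (input size = an ε-Hölder size of λ plus
its sup), (3.45) (its Hölder norm), (3.46)₄ *"‖h∇_UG′(U)∇*_Uλ‖"*, together with the p. 398 remark *"Using Lemma 2.1 in
[4] we may replace the factor (L^jη)^α by (L^jη)^β(L^{j′}η)^γ with β + γ = α, j, j′ are indices of localizations"* — the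
scale transfer (2.60) of [4] Lemma 2.1 p. 234, which moves a power of L^jη sitting at an intermediate point of the walk
to an end point at the price of a part of the decay rate.

WHAT THIS FILE CERTIFIES (0 sorry; theorems only; no `def`, no new named fact).  Three block-normed spaces in the
vocabulary of `…B11SectG`: `b₀` on F₀ (the input of A : F₀ → F₁), `b₁` on F₁ (where G′, G′₀, R′ act), `b₂` on F₂ (the
output of E : F₁ → F₂).  With G′ = G′₀ + G′R′ ((3.90), `B9Thm37Sum.fixedPoint_of_388`) one has, for every N,
EG′A = Σ_{n<N} EG′₀R′ⁿA + EG′R′ᴺA (`telescope_ring`), and the n-th term factors as (EG′₀)·R′ⁿ⁻¹·(R′A) (n ≥ 1).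
* §1 tools: `telescope_ring` (the telescoping of (3.90) in any ring); `term_pow_left` (the bound of FILE 1's n-th term
  (EG′₀)R′ᵐ from `b₁` into `b₂`, exported: A·c₁(α)·W(y)·(κ₁θc₁(α))ᵐ·e^{−(1−α)δ₀d}); `conv_transfer_le` (the junction
  sum Σ_{y″} e^{−(1−α)δ₀d(y,y″)}·V(y″)·e^{−δ₀d(y″,y′)} ≤ C_T·V′(y)·c₁(α)·e^{−(1−2α)δ₀d(y,y′)} under the (2.60)-type
  TRANSFER hypothesis V(y″)e^{−αδ₀d(y,y″)} ≤ C_T·V′(y) and a symmetric distance).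
* §2 **`twoSided_series`** — THEOREM 3.7 FOR A TWO-SIDED MEMBER EG′A FROM `b₀` INTO `b₂`: from the summed two-sided legs
  EG′₀A (majorant A₂W₀(y)Q(y′)e^{−δ₀d}: Cor. 3.6's two-sided member for the G′_□, e.g. (3.44)), the summed left legs
  EG′₀ (A₁W(y)e^{−δ₀d}), R′ in `b₁` (θe^{−δ₀d}, (3.89) summed), the summed terms R′A (θ_A·V(y)·Q(y′)e^{−δ₀d}: (3.89) with
  A on the right — from Cor. 3.6's A-member and two-sided member of G′_□ through the coefficients of K(h_□)), the
  transfer hypothesis for the junction weight V, Lemma 2.1 of [4] at α (d symmetric), κ₁θc₁(α) < 1 and an a-priori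
  constant majorant of EG′: EG′A has majorant (A₂W₀(y) + A₁κ₁θ_AC_Tc₁(α)²(1 − κ₁θc₁(α))⁻¹W(y)V′(y))·Q(y′)·
  e^{−(1−2α)δ₀d(y,y′)} (rate (1 − 2α)δ₀: one α for the walk, one for the transfer — *"with different constants"*).
* §3 **`thm37_twoSided`** — the same from the per-cube data of (3.87)–(3.88): legs and (3.89)-terms localized to S_□ /
  S′_□ with the overlap counts N, N′, G′Δ′_a = I and (3.88) summed (`B9Thm37Sum.fixedPoint_of_388`).

HONEST SCOPE.  As in the two previous files, every analytic input is a hypothesis of the printed shape (Cor. 3.6's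
members for the local operators G′_□ incl. the two-sided one; (3.89) and its A-composed form; (3.88) summed; the
transfer (2.60)); the distance is assumed symmetric; the a-priori bound `hap` (finite lattice) is an input for abstract
norms; the rate comes out as (1 − 2α)δ₀.  Value = kernel-checked bookkeeping of a printed *"we will not repeat them
here"*, NOT summit progress; nothing continuum, nothing about the mass gap.  Seat `pub-ymgap-dag-n06-b` (HUMAN RULING
D-0062, node N06), 2026-08-25; rows B9.Thm3.7 × B9.Cor3.8 × (3.44)/(3.45)/(3.46) (cells only).
-/

namespace Literature.MathematicalPhysics.QuantumFieldTheory.Balaban1983to89.B9Thm37AllNormsTwoSided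

open Literature.MathematicalPhysics.QuantumFieldTheory.Balaban1983to89
open Finset B6RandomWalk B9Thm37Sum B11SectG B9Thm37AllNorms B9Thm37AllNormsRight

noncomputable section

/-! ## §1  Tools: telescoping in a ring, the n-th left term, the junction sum with scale transfer -/

section Tools

variable {G : B6.Geometry}
variable {F₁ F₂ : Type} [AddCommGroup F₁] [Module ℝ F₁] [AddCommGroup F₂] [Module ℝ F₂]

omit G in
/-- (3.90) telescoped in any ring: g = g₀ + g·r gives g = Σ_{n<N} g₀rⁿ + g·rᴺ ([4] (2.50)). [cite: Balaban1985BackgroundPropagators, (3.90) p.409] -/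
theorem telescope_ring {A : Type*} [Ring A] {g g0 r : A} (hfix : g = g0 + g * r) (N : ℕ) :
    g = (∑ n ∈ Finset.range N, g0 * r ^ n) + g * r ^ N := by
  induction N with
  | zero => simp
  | succ N ih =>
      calc g = (∑ n ∈ Finset.range N, g0 * r ^ n) + g * r ^ N := ih
        _ = (∑ n ∈ Finset.range N, g0 * r ^ n) + (g0 + g * r) * r ^ N := by rw [← hfix]
        _ = (∑ n ∈ Finset.range (N + 1), g0 * r ^ n) + g * r ^ (N + 1) := by
            rw [add_mul, mul_assoc, ← pow_succ', Finset.sum_range_succ, add_assoc]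

/-- **The n-th left term (EG′₀)R′ᵐ of (3.90) from `b₁` into `b₂`** (the bound inside `B9Thm37AllNorms.neumann_right`,
exported): S with majorant AW(y)e^{−δ₀d} from `b₁` into `b₂` and R′ with θe^{−δ₀d} in `b₁` give SR′ᵐ the majorant
A·c₁(α)·W(y)·(κ₁θc₁(α))ᵐ·e^{−(1−α)δ₀d} ([4] (2.63)–(2.66); c₁(α) ≥ 1 takes care of m = 0).
[cite: Balaban1985BackgroundPropagators, Thm 3.7 (3.90) pp.409–410; Balaban1984PropagatorsII, (2.64)–(2.66) p.234] -/
theorem term_pow_left (b₁ : BlockNorm G F₁) (b₂ : BlockNorm G F₂) (d : ℕ) (δ₀ α θ A : ℝ) (W : G.Site → ℝ)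
    {S : F₁ →ₗ[ℝ] F₂} {R : Module.End ℝ F₁}
    (hA : 0 ≤ A) (hW : ∀ y, 0 ≤ W y) (hθ : 0 ≤ θ) (hαδ : 0 ≤ α * δ₀) (h1αδ : 0 ≤ (1 - α) * δ₀)
    (htri : Triangle254 G) (hrefl : ∀ y : G.Site, G.dist y y = 0) (hdnn : ∀ y y' : G.Site, 0 ≤ G.dist y y')
    (h261 : Ineq261 d G δ₀ α) (h263 : Ineq263 d G δ₀ α)
    (hS : HasMaj b₁ b₂ S (fun a c => A * W a * Real.exp (-(δ₀ * G.dist a c))))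
    (hR : HasMaj b₁ b₁ R (fun a c => θ * Real.exp (-(δ₀ * G.dist a c)))) (m : ℕ) :
    HasMaj b₁ b₂ (S ∘ₗ (R ^ m))
      (fun a c => A * B6.c1 d δ₀ α * W a * (b₁.κ * θ * B6.c1 d δ₀ α) ^ m *
        Real.exp (-((1 - α) * δ₀ * G.dist a c))) := by
  set cα : ℝ := B6.c1 d δ₀ α with hcα
  set q : ℝ := b₁.κ * θ * cα with hqdef
  have hc0 : 0 ≤ cα := c1_nonneg d δ₀ α
  have hq0 : 0 ≤ q := mul_nonneg (mul_nonneg b₁.κ_nonneg hθ) hc0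
  by_cases hne : Nonempty G.Site
  swap
  · intro y' μ _ y
    exact (hne ⟨y⟩).elim
  have hc1 : 1 ≤ cα := one_le_c1_of_ineq261 d δ₀ α hrefl h261 (Classical.arbitrary _)
  cases m with
  | zero =>
      refine (hS.congr fun μ => ?_).mono fun a c => ?_
      · rw [LinearMap.comp_apply, pow_zero, Module.End.one_apply]
      · have hexp : Real.exp (-(δ₀ * G.dist a c)) ≤ Real.exp (-((1 - α) * δ₀ * G.dist a c)) := by
          refine Real.exp_le_exp.mpr ?_
          have := mul_nonneg hαδ (hdnn a c)
          nlinarith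
        have hAW : 0 ≤ A * W a := mul_nonneg hA (hW a)
        have h2 : 0 ≤ W a * q ^ 0 * Real.exp (-((1 - α) * δ₀ * G.dist a c)) :=
          mul_nonneg (mul_nonneg (hW a) (pow_nonneg hq0 0)) (Real.exp_nonneg _)
        calc A * W a * Real.exp (-(δ₀ * G.dist a c)) ≤ A * W a * Real.exp (-((1 - α) * δ₀ * G.dist a c)) :=
              mul_le_mul_of_nonneg_left hexp hAW
          _ = A * 1 * (W a * q ^ 0 * Real.exp (-((1 - α) * δ₀ * G.dist a c))) := by ring
          _ ≤ A * cα * (W a * q ^ 0 * Real.exp (-((1 - α) * δ₀ * G.dist a c))) :=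
              mul_le_mul_of_nonneg_right (mul_le_mul_of_nonneg_left hc1 hA) h2
          _ = _ := by ring
  | succ m =>
      -- (2.63): R′ᵐ⁺¹ has majorant κ₁ᵐ(θc₁)ᵐ⁺¹e^{−(1−α)δ₀d}
      have hRn : HasMaj b₁ b₁ (R ^ (m + 1))
          (fun a c => b₁.κ ^ m * (θ * cα) ^ (m + 1) * Real.exp (-((1 - α) * δ₀ * G.dist a c))) := by
        refine (hasMaj_pow_chain b₁ hR (fun a c => mul_nonneg hθ (Real.exp_nonneg _)) m).mono fun a c => ?_
        rw [chain_const_mul, mul_pow]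
        have hnn : 0 ≤ b₁.κ ^ m * θ ^ (m + 1) := mul_nonneg (pow_nonneg b₁.κ_nonneg m) (pow_nonneg hθ _)
        calc b₁.κ ^ m * (θ ^ (m + 1) * chain (fun a c => Real.exp (-(δ₀ * G.dist a c))) m a c)
            = b₁.κ ^ m * θ ^ (m + 1) * chain (fun a c => Real.exp (-(δ₀ * G.dist a c))) m a c := by ring
          _ ≤ b₁.κ ^ m * θ ^ (m + 1) * (cα ^ (m + 1) * Real.exp (-((1 - α) * δ₀ * G.dist a c))) :=
              mul_le_mul_of_nonneg_left (h263 m a c) hnn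
          _ = _ := by ring
      have h := hasMaj_comp hS hRn (fun a c => mul_nonneg (mul_nonneg hA (hW a)) (Real.exp_nonneg _))
      refine h.mono fun a c => ?_
      have hr : 0 ≤ b₁.κ * (b₁.κ ^ m * (θ * cα) ^ (m + 1)) :=
        mul_nonneg b₁.κ_nonneg (mul_nonneg (pow_nonneg b₁.κ_nonneg m) (pow_nonneg (mul_nonneg hθ hc0) _))
      have hconv := conv_weight_le d δ₀ α A (b₁.κ * (b₁.κ ^ m * (θ * cα) ^ (m + 1))) W hA hW hr h1αδ htri h261 a c
      have hq' : b₁.κ * (b₁.κ ^ m * (θ * cα) ^ (m + 1)) = q ^ (m + 1) := by rw [hqdef]; ring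
      calc ∑ y'', A * W a * Real.exp (-(δ₀ * G.dist a y'')) *
            (b₁.κ * (b₁.κ ^ m * (θ * cα) ^ (m + 1) * Real.exp (-((1 - α) * δ₀ * G.dist y'' c))))
          = ∑ y'', A * W a * Real.exp (-(δ₀ * G.dist a y'')) *
            (b₁.κ * (b₁.κ ^ m * (θ * cα) ^ (m + 1)) * Real.exp (-((1 - α) * δ₀ * G.dist y'' c))) :=
            Finset.sum_congr rfl fun y'' _ => by ring
        _ ≤ A * cα * W a * (b₁.κ * (b₁.κ ^ m * (θ * cα) ^ (m + 1))) * Real.exp (-((1 - α) * δ₀ * G.dist a c)) :=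
            hconv
        _ = A * cα * W a * q ^ (m + 1) * Real.exp (-((1 - α) * δ₀ * G.dist a c)) := by rw [hq']

omit [AddCommGroup F₁] [Module ℝ F₁] [AddCommGroup F₂] [Module ℝ F₂] in
/-- **The column convolution at two rates** (symmetric distance): if 0 ≤ ρ, ρ + σ ≤ δ and the row sum of [4] (2.61)
holds at the rate σ with constant c, then Σ_{y″} r·e^{−ρd(y,y″)}·(A·e^{−δd(y″,y′)}) ≤ r·A·c·e^{−ρd(y,y′)} — split the
second factor, the triangle inequality (2.54), the row sum at y′ read as a column sum.
[cite: Balaban1984PropagatorsII, (2.54) p.233, (2.61) p.234] -/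
theorem conv_col_le (ρ δ σ c r A : ℝ) (hr : 0 ≤ r) (hA : 0 ≤ A) (hρ : 0 ≤ ρ) (hρσ : ρ + σ ≤ δ)
    (htri : Triangle254 G) (hdnn : ∀ y y' : G.Site, 0 ≤ G.dist y y')
    (hsymm : ∀ a c : G.Site, G.dist a c = G.dist c a) (hrow : RowSum G σ c) (a e : G.Site) :
    ∑ y'' : G.Site, r * Real.exp (-(ρ * G.dist a y'')) * (A * Real.exp (-(δ * G.dist y'' e))) ≤
      r * A * c * Real.exp (-(ρ * G.dist a e)) := by
  have hterm : ∀ y'' : G.Site,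
      r * Real.exp (-(ρ * G.dist a y'')) * (A * Real.exp (-(δ * G.dist y'' e))) ≤
        r * A * Real.exp (-(ρ * G.dist a e)) * Real.exp (-(σ * G.dist e y'')) := by
    intro y''
    have hexp : Real.exp (-(ρ * G.dist a y'')) * Real.exp (-(δ * G.dist y'' e)) ≤
        Real.exp (-(ρ * G.dist a e)) * Real.exp (-(σ * G.dist e y'')) := by
      rw [← Real.exp_add, ← Real.exp_add]
      refine Real.exp_le_exp.mpr ?_
      have h1 := mul_le_mul_of_nonneg_left (htri a y'' e) hρ
      have h2 : G.dist e y'' = G.dist y'' e := hsymm e y''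
      have h3 : (ρ + σ) * G.dist y'' e ≤ δ * G.dist y'' e := mul_le_mul_of_nonneg_right hρσ (hdnn _ _)
      rw [h2]
      nlinarith
    have := mul_le_mul_of_nonneg_left hexp (mul_nonneg hr hA)
    calc r * Real.exp (-(ρ * G.dist a y'')) * (A * Real.exp (-(δ * G.dist y'' e)))
        = r * A * (Real.exp (-(ρ * G.dist a y'')) * Real.exp (-(δ * G.dist y'' e))) := by ring
      _ ≤ r * A * (Real.exp (-(ρ * G.dist a e)) * Real.exp (-(σ * G.dist e y''))) := this
      _ = _ := by ring
  calc ∑ y'' : G.Site, r * Real.exp (-(ρ * G.dist a y'')) * (A * Real.exp (-(δ * G.dist y'' e)))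
      ≤ ∑ y'' : G.Site, r * A * Real.exp (-(ρ * G.dist a e)) * Real.exp (-(σ * G.dist e y'')) :=
        Finset.sum_le_sum fun y'' _ => hterm y''
    _ = r * A * Real.exp (-(ρ * G.dist a e)) * ∑ y'' : G.Site, Real.exp (-(σ * G.dist e y'')) := by
        rw [Finset.mul_sum]
    _ ≤ r * A * Real.exp (-(ρ * G.dist a e)) * c :=
        mul_le_mul_of_nonneg_left (hrow e) (mul_nonneg (mul_nonneg hr hA) (Real.exp_nonneg _))
    _ = r * A * c * Real.exp (-(ρ * G.dist a e)) := by ring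

omit [AddCommGroup F₁] [Module ℝ F₁] [AddCommGroup F₂] [Module ℝ F₂] in
/-- **The junction sum with scale transfer** (the p. 398 remark *"we may replace the factor (L^jη)^α by
(L^jη)^β(L^{j′}η)^γ"* via [4] (2.60)): if V(y″)e^{−αδ₀d(y,y″)} ≤ C_T·V′(y) (a weight at the intermediate point moved to
the end point y at the cost αδ₀ of rate), d is symmetric and (2.61) holds at the rate α, then
Σ_{y″} r·e^{−(1−α)δ₀d(y,y″)}·(V(y″)·A·e^{−δ₀d(y″,y′)}) ≤ r·C_T·V′(y)·A·c₁(α)·e^{−(1−2α)δ₀d(y,y′)}.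
[cite: Balaban1984PropagatorsII, Lemma 2.1 (2.60)–(2.61) p.234; Balaban1985BackgroundPropagators, p.398] -/
theorem conv_transfer_le (d : ℕ) (δ₀ α r A C_T : ℝ) (V V' : G.Site → ℝ) (hr : 0 ≤ r) (hA : 0 ≤ A) (hC : 0 ≤ C_T)
    (hV' : ∀ y, 0 ≤ V' y) (hαδ : 0 ≤ α * δ₀) (h2αδ : 0 ≤ (1 - 2 * α) * δ₀)
    (htri : Triangle254 G) (hdnn : ∀ y y' : G.Site, 0 ≤ G.dist y y')
    (hsymm : ∀ a c : G.Site, G.dist a c = G.dist c a) (h261 : Ineq261 d G δ₀ α)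
    (htransfer : ∀ a y'' : G.Site, V y'' * Real.exp (-(α * δ₀ * G.dist a y'')) ≤ C_T * V' a) (a e : G.Site) :
    ∑ y'' : G.Site, r * Real.exp (-((1 - α) * δ₀ * G.dist a y'')) * (V y'' * A * Real.exp (-(δ₀ * G.dist y'' e))) ≤
      r * C_T * V' a * A * B6.c1 d δ₀ α * Real.exp (-((1 - 2 * α) * δ₀ * G.dist a e)) := by
  -- peel the transfer factor e^{−αδ₀d(a,y″)} off the first exponential
  have hterm : ∀ y'' : G.Site,
      r * Real.exp (-((1 - α) * δ₀ * G.dist a y'')) * (V y'' * A * Real.exp (-(δ₀ * G.dist y'' e))) ≤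
        r * C_T * V' a * Real.exp (-((1 - 2 * α) * δ₀ * G.dist a y'')) * (A * Real.exp (-(δ₀ * G.dist y'' e))) := by
    intro y''
    have hsplit : Real.exp (-((1 - α) * δ₀ * G.dist a y'')) =
        Real.exp (-((1 - 2 * α) * δ₀ * G.dist a y'')) * Real.exp (-(α * δ₀ * G.dist a y'')) := by
      rw [← Real.exp_add]; congr 1; ring
    have ht := htransfer a y''
    have hE : 0 ≤ Real.exp (-((1 - 2 * α) * δ₀ * G.dist a y'')) * (A * Real.exp (-(δ₀ * G.dist y'' e))) :=
      mul_nonneg (Real.exp_nonneg _) (mul_nonneg hA (Real.exp_nonneg _))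
    calc r * Real.exp (-((1 - α) * δ₀ * G.dist a y'')) * (V y'' * A * Real.exp (-(δ₀ * G.dist y'' e)))
        = r * (V y'' * Real.exp (-(α * δ₀ * G.dist a y''))) *
            (Real.exp (-((1 - 2 * α) * δ₀ * G.dist a y'')) * (A * Real.exp (-(δ₀ * G.dist y'' e)))) := by
          rw [hsplit]; ring
      _ ≤ r * (C_T * V' a) *
            (Real.exp (-((1 - 2 * α) * δ₀ * G.dist a y'')) * (A * Real.exp (-(δ₀ * G.dist y'' e)))) :=
          mul_le_mul_of_nonneg_right (mul_le_mul_of_nonneg_left ht hr) hE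
      _ = _ := by ring
  have hrow : RowSum G (α * δ₀) (B6.c1 d δ₀ α) := (rowSum_iff_ineq261 d G δ₀ α).mp h261
  have hconv := conv_col_le (G := G) ((1 - 2 * α) * δ₀) δ₀ (α * δ₀) (B6.c1 d δ₀ α) (r * C_T * V' a) A
    (mul_nonneg (mul_nonneg hr hC) (hV' a)) hA h2αδ (by nlinarith) htri hdnn hsymm hrow a e
  calc ∑ y'' : G.Site, r * Real.exp (-((1 - α) * δ₀ * G.dist a y'')) * (V y'' * A * Real.exp (-(δ₀ * G.dist y'' e)))
      ≤ ∑ y'' : G.Site, r * C_T * V' a * Real.exp (-((1 - 2 * α) * δ₀ * G.dist a y'')) *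
          (A * Real.exp (-(δ₀ * G.dist y'' e))) := Finset.sum_le_sum fun y'' _ => hterm y''
    _ ≤ r * C_T * V' a * A * B6.c1 d δ₀ α * Real.exp (-((1 - 2 * α) * δ₀ * G.dist a e)) := hconv

end Tools

/-! ## §2  Theorem 3.7 for a TWO-SIDED member: the series Σₙ EG′₀R′ⁿA over block norms -/

section TwoSided

variable {G : B6.Geometry}
variable {F₀ F₁ F₂ : Type} [AddCommGroup F₀] [Module ℝ F₀] [AddCommGroup F₁] [Module ℝ F₁]
  [AddCommGroup F₂] [Module ℝ F₂]

/-- **THEOREM 3.7 ⇒ a TWO-SIDED member EG′A of (3.42)–(3.47) for G′, from `b₀` into `b₂`** (p. 409: *"The expansion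
is convergent in all norms appearing in the inequalities (3.42)–(3.47)"*; (3.44) ∇_UG′∇*_U with the ε-Hölder input size,
(3.45), (3.46)₄ ‖h∇_UG′∇*_Uλ‖), summed as the series Σₙ EG′₀R′ⁿA of (3.90): the term n = 0 is the two-sided leg EG′₀A
(`hEG0A`, majorant A₂W₀(y)Q(y′)e^{−δ₀d}: Cor. 3.6's two-sided member for the G′_□, summed over the cubes); for n ≥ 1 the
term factors as (EG′₀)·R′ⁿ⁻¹·(R′A) with EG′₀ majorised from `b₁` into `b₂` by A₁W(y)e^{−δ₀d} (`hEG0`, left legs),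
R′ in `b₁` by θe^{−δ₀d} (`hR`, (3.89) summed) and R′A from `b₀` into `b₁` by θ_A·V(y)·Q(y′)e^{−δ₀d} (`hRA`: (3.89) with
A on the right — its output weight V sits at the JUNCTION of the walk and is moved to the output end by the transfer
hypothesis `htransfer`, [4] (2.60), at the cost αδ₀ of rate); G′ = G′₀ + G′R′ (`hfix`, (3.90)); Lemma 2.1 of [4] at α,
d symmetric; κ₁θc₁(α) < 1; an a-priori constant majorant of EG′ (`hap`).  Conclusion: EG′A has majorant
(A₂W₀(y) + A₁κ₁θ_AC_Tc₁(α)²(1 − κ₁θc₁(α))⁻¹W(y)V′(y))·Q(y′)·e^{−(1−2α)δ₀d(y,y′)}.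
[cite: Balaban1985BackgroundPropagators, Thm 3.7 (3.90) pp.409–410, (3.44)–(3.46) p.398; Balaban1984PropagatorsII, (2.60)–(2.66) p.234] -/
theorem twoSided_series (b₀ : BlockNorm G F₀) (b₁ : BlockNorm G F₁) (b₂ : BlockNorm G F₂)
    (E : F₁ →ₗ[ℝ] F₂) (Aop : F₀ →ₗ[ℝ] F₁) (d : ℕ) (δ₀ α θ θA A₁ A₂ C_T M₀ : ℝ) (W W₀ V V' Q : G.Site → ℝ)
    {G' G0 R : Module.End ℝ F₁}
    (hθ : 0 ≤ θ) (hθA : 0 ≤ θA) (hA₁ : 0 ≤ A₁) (hA₂ : 0 ≤ A₂) (hC : 0 ≤ C_T) (hM₀ : 0 ≤ M₀)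
    (hW : ∀ y, 0 ≤ W y) (hW₀ : ∀ y, 0 ≤ W₀ y) (hV : ∀ y, 0 ≤ V y) (hV' : ∀ y, 0 ≤ V' y) (hQ : ∀ y, 0 ≤ Q y)
    (hαδ : 0 ≤ α * δ₀) (h2αδ : 0 ≤ (1 - 2 * α) * δ₀)
    (htri : Triangle254 G) (hrefl : ∀ y : G.Site, G.dist y y = 0) (hdnn : ∀ y y' : G.Site, 0 ≤ G.dist y y')
    (hsymm : ∀ a c : G.Site, G.dist a c = G.dist c a) (h261 : Ineq261 d G δ₀ α) (h263 : Ineq263 d G δ₀ α)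
    (hsmall : b₁.κ * θ * B6.c1 d δ₀ α < 1)
    (hEG0 : HasMaj b₁ b₂ (E ∘ₗ G0) (fun a c => A₁ * W a * Real.exp (-(δ₀ * G.dist a c))))
    (hEG0A : HasMaj b₀ b₂ (E ∘ₗ G0 ∘ₗ Aop) (fun a c => A₂ * W₀ a * Q c * Real.exp (-(δ₀ * G.dist a c))))
    (hR : HasMaj b₁ b₁ R (fun a c => θ * Real.exp (-(δ₀ * G.dist a c))))
    (hRA : HasMaj b₀ b₁ (R ∘ₗ Aop) (fun a c => θA * V a * Q c * Real.exp (-(δ₀ * G.dist a c))))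
    (htransfer : ∀ a y'' : G.Site, V y'' * Real.exp (-(α * δ₀ * G.dist a y'')) ≤ C_T * V' a)
    (hfix : G' = G0 + G' * R)
    (hap : HasMaj b₁ b₂ (E ∘ₗ G') (fun _ _ => M₀)) :
    HasMaj b₀ b₂ (E ∘ₗ G' ∘ₗ Aop)
      (fun a c => (A₂ * W₀ a + A₁ * b₁.κ * θA * C_T * B6.c1 d δ₀ α ^ 2 *
          (1 - b₁.κ * θ * B6.c1 d δ₀ α)⁻¹ * W a * V' a) * Q c *
        Real.exp (-((1 - 2 * α) * δ₀ * G.dist a c))) := by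
  set cα : ℝ := B6.c1 d δ₀ α with hcα
  set q : ℝ := b₁.κ * θ * cα with hqdef
  have hc0 : 0 ≤ cα := c1_nonneg d δ₀ α
  have hq0 : 0 ≤ q := mul_nonneg (mul_nonneg b₁.κ_nonneg hθ) hc0
  have h1αδ : 0 ≤ (1 - α) * δ₀ := by nlinarith
  -- the terms n ≥ 1: (EG′₀)·R′ᵐ·(R′A), m = n − 1
  have hleft : ∀ m : ℕ, HasMaj b₁ b₂ ((E ∘ₗ G0) ∘ₗ (R ^ m))
      (fun a c => A₁ * cα * W a * q ^ m * Real.exp (-((1 - α) * δ₀ * G.dist a c))) := fun m =>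
    term_pow_left b₁ b₂ d δ₀ α θ A₁ W hA₁ hW hθ hαδ h1αδ htri hrefl hdnn h261 h263 hEG0 hR m
  have hterm : ∀ m : ℕ, HasMaj b₀ b₂ (((E ∘ₗ G0) ∘ₗ (R ^ m)) ∘ₗ (R ∘ₗ Aop))
      (fun a c => A₁ * cα * b₁.κ * θA * C_T * cα * W a * V' a * Q c * q ^ m *
        Real.exp (-((1 - 2 * α) * δ₀ * G.dist a c))) := by
    intro m
    have h := hasMaj_comp (hleft m) hRA (fun a c => mul_nonneg (mul_nonneg (mul_nonneg
      (mul_nonneg hA₁ hc0) (hW a)) (pow_nonneg hq0 m)) (Real.exp_nonneg _))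
    refine h.mono fun a c => ?_
    have hr : 0 ≤ A₁ * cα * W a * q ^ m * b₁.κ * θA * Q c :=
      mul_nonneg (mul_nonneg (mul_nonneg (mul_nonneg (mul_nonneg (mul_nonneg hA₁ hc0) (hW a))
        (pow_nonneg hq0 m)) b₁.κ_nonneg) hθA) (hQ c)
    have hconv := conv_transfer_le (G := G) d δ₀ α (A₁ * cα * W a * q ^ m * b₁.κ * θA * Q c) 1 C_T V V' hr
      zero_le_one hC hV' hαδ h2αδ htri hdnn hsymm h261 htransfer a c
    calc ∑ y'', A₁ * cα * W a * q ^ m * Real.exp (-((1 - α) * δ₀ * G.dist a y'')) *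
          (b₁.κ * (θA * V y'' * Q c * Real.exp (-(δ₀ * G.dist y'' c))))
        = ∑ y'', A₁ * cα * W a * q ^ m * b₁.κ * θA * Q c * Real.exp (-((1 - α) * δ₀ * G.dist a y'')) *
          (V y'' * 1 * Real.exp (-(δ₀ * G.dist y'' c))) := Finset.sum_congr rfl fun y'' _ => by ring
      _ ≤ A₁ * cα * W a * q ^ m * b₁.κ * θA * Q c * C_T * V' a * 1 * cα *
          Real.exp (-((1 - 2 * α) * δ₀ * G.dist a c)) := hconv
      _ = _ := by ring
  -- the term n = 0: EG′₀A at the weaker rate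
  have hzero : HasMaj b₀ b₂ (E ∘ₗ G0 ∘ₗ Aop)
      (fun a c => A₂ * W₀ a * Q c * Real.exp (-((1 - 2 * α) * δ₀ * G.dist a c))) := by
    refine hEG0A.mono fun a c => ?_
    have hexp : Real.exp (-(δ₀ * G.dist a c)) ≤ Real.exp (-((1 - 2 * α) * δ₀ * G.dist a c)) := by
      refine Real.exp_le_exp.mpr ?_
      have := mul_nonneg hαδ (hdnn a c)
      nlinarith
    exact mul_le_mul_of_nonneg_left hexp (mul_nonneg (mul_nonneg hA₂ (hW₀ a)) (hQ c))
  -- partial sums of the terms n ≥ 1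
  have hpartial : ∀ N : ℕ, HasMaj b₀ b₂ (∑ m ∈ Finset.range N, ((E ∘ₗ G0) ∘ₗ (R ^ m)) ∘ₗ (R ∘ₗ Aop))
      (fun a c => ∑ m ∈ Finset.range N, A₁ * cα * b₁.κ * θA * C_T * cα * W a * V' a * Q c * q ^ m *
        Real.exp (-((1 - 2 * α) * δ₀ * G.dist a c))) :=
    fun N => hasMaj_sum (fun m => ((E ∘ₗ G0) ∘ₗ (R ^ m)) ∘ₗ (R ∘ₗ Aop)) _ hterm N
  -- the remainder (EG′)·R′ᴺ·(R′A): constant·Q(y′)·qᴺ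
  set SV : ℝ := ∑ y'' : G.Site, V y'' with hSV
  have hSV0 : 0 ≤ SV := Finset.sum_nonneg fun y _ => hV y
  set Cst : ℝ := ((Fintype.card G.Site : ℝ) + 1) * M₀ * b₁.κ * θA * SV with hCst
  have hCst0 : 0 ≤ Cst :=
    mul_nonneg (mul_nonneg (mul_nonneg (mul_nonneg (by positivity) hM₀) b₁.κ_nonneg) hθA) hSV0
  have hremL : ∀ N : ℕ, HasMaj b₁ b₂ ((E ∘ₗ G') ∘ₗ (R ^ N))
      (fun _ _ => ((Fintype.card G.Site : ℝ) + 1) * M₀ * q ^ N) := by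
    intro N
    cases N with
    | zero =>
        refine (hap.congr fun μ => ?_).mono fun a c => ?_
        · simp only [LinearMap.comp_apply, pow_zero, Module.End.one_apply]
        · rw [pow_zero, mul_one]
          have : (0 : ℝ) ≤ (Fintype.card G.Site : ℝ) := Nat.cast_nonneg _
          nlinarith
    | succ m =>
        have hRn : HasMaj b₁ b₁ (R ^ (m + 1))
            (fun a c => b₁.κ ^ m * (θ * cα) ^ (m + 1) * Real.exp (-((1 - α) * δ₀ * G.dist a c))) := by
          refine (hasMaj_pow_chain b₁ hR (fun a c => mul_nonneg hθ (Real.exp_nonneg _)) m).mono fun a c => ?_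
          rw [chain_const_mul, mul_pow]
          have hnn : 0 ≤ b₁.κ ^ m * θ ^ (m + 1) := mul_nonneg (pow_nonneg b₁.κ_nonneg m) (pow_nonneg hθ _)
          calc b₁.κ ^ m * (θ ^ (m + 1) * chain (fun a c => Real.exp (-(δ₀ * G.dist a c))) m a c)
              = b₁.κ ^ m * θ ^ (m + 1) * chain (fun a c => Real.exp (-(δ₀ * G.dist a c))) m a c := by ring
            _ ≤ b₁.κ ^ m * θ ^ (m + 1) * (cα ^ (m + 1) * Real.exp (-((1 - α) * δ₀ * G.dist a c))) :=
                mul_le_mul_of_nonneg_left (h263 m a c) hnn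
            _ = _ := by ring
        have h := hasMaj_comp hap hRn (fun _ _ => hM₀)
        refine h.mono fun a c => ?_
        have hq' : b₁.κ * (b₁.κ ^ m * (θ * cα) ^ (m + 1)) = q ^ (m + 1) := by rw [hqdef]; ring
        have hle : ∀ y'' : G.Site, M₀ * (b₁.κ * (b₁.κ ^ m * (θ * cα) ^ (m + 1) *
            Real.exp (-((1 - α) * δ₀ * G.dist y'' c)))) ≤ M₀ * q ^ (m + 1) := by
          intro y''
          have hexp : Real.exp (-((1 - α) * δ₀ * G.dist y'' c)) ≤ 1 := by
            rw [Real.exp_le_one_iff]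
            have := mul_nonneg h1αδ (hdnn y'' c)
            linarith
          have hr : 0 ≤ b₁.κ * (b₁.κ ^ m * (θ * cα) ^ (m + 1)) :=
            mul_nonneg b₁.κ_nonneg (mul_nonneg (pow_nonneg b₁.κ_nonneg m) (pow_nonneg (mul_nonneg hθ hc0) _))
          calc M₀ * (b₁.κ * (b₁.κ ^ m * (θ * cα) ^ (m + 1) * Real.exp (-((1 - α) * δ₀ * G.dist y'' c))))
              = M₀ * (b₁.κ * (b₁.κ ^ m * (θ * cα) ^ (m + 1))) * Real.exp (-((1 - α) * δ₀ * G.dist y'' c)) := by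
                ring
            _ ≤ M₀ * (b₁.κ * (b₁.κ ^ m * (θ * cα) ^ (m + 1))) * 1 :=
                mul_le_mul_of_nonneg_left hexp (mul_nonneg hM₀ hr)
            _ = M₀ * q ^ (m + 1) := by rw [mul_one, hq']
        calc ∑ y'' : G.Site, M₀ * (b₁.κ * (b₁.κ ^ m * (θ * cα) ^ (m + 1) *
              Real.exp (-((1 - α) * δ₀ * G.dist y'' c))))
            ≤ ∑ _y'' : G.Site, M₀ * q ^ (m + 1) := Finset.sum_le_sum fun y'' _ => hle y''
          _ = (Fintype.card G.Site : ℝ) * (M₀ * q ^ (m + 1)) := by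
              rw [Finset.sum_const, nsmul_eq_mul, Finset.card_univ]
          _ ≤ ((Fintype.card G.Site : ℝ) + 1) * (M₀ * q ^ (m + 1)) :=
              mul_le_mul_of_nonneg_right (by linarith) (mul_nonneg hM₀ (pow_nonneg hq0 _))
          _ = _ := by ring
  have hrem : ∀ N : ℕ, HasMaj b₀ b₂ (((E ∘ₗ G') ∘ₗ (R ^ N)) ∘ₗ (R ∘ₗ Aop)) (fun _ c => Cst * Q c * q ^ N) := by
    intro N
    have h := hasMaj_comp (hremL N) hRA (fun _ _ => mul_nonneg (mul_nonneg (by positivity) hM₀) (pow_nonneg hq0 N))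
    refine h.mono fun a c => ?_
    have hle : ∀ y'' : G.Site, ((Fintype.card G.Site : ℝ) + 1) * M₀ * q ^ N *
        (b₁.κ * (θA * V y'' * Q c * Real.exp (-(δ₀ * G.dist y'' c)))) ≤
        ((Fintype.card G.Site : ℝ) + 1) * M₀ * b₁.κ * θA * Q c * q ^ N * V y'' := by
      intro y''
      have hexp : Real.exp (-(δ₀ * G.dist y'' c)) ≤ 1 := by
        rw [Real.exp_le_one_iff]
        have h0 : 0 ≤ δ₀ := by nlinarith
        have := mul_nonneg h0 (hdnn y'' c)
        linarith
      have hbase : 0 ≤ ((Fintype.card G.Site : ℝ) + 1) * M₀ * b₁.κ * θA * Q c * q ^ N * V y'' :=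
        mul_nonneg (mul_nonneg (mul_nonneg (mul_nonneg (mul_nonneg (mul_nonneg (by positivity) hM₀)
          b₁.κ_nonneg) hθA) (hQ c)) (pow_nonneg hq0 N)) (hV y'')
      calc ((Fintype.card G.Site : ℝ) + 1) * M₀ * q ^ N *
            (b₁.κ * (θA * V y'' * Q c * Real.exp (-(δ₀ * G.dist y'' c))))
          = ((Fintype.card G.Site : ℝ) + 1) * M₀ * b₁.κ * θA * Q c * q ^ N * V y'' *
              Real.exp (-(δ₀ * G.dist y'' c)) := by ring
        _ ≤ ((Fintype.card G.Site : ℝ) + 1) * M₀ * b₁.κ * θA * Q c * q ^ N * V y'' * 1 :=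
            mul_le_mul_of_nonneg_left hexp hbase
        _ = _ := by rw [mul_one]
    calc ∑ y'' : G.Site, ((Fintype.card G.Site : ℝ) + 1) * M₀ * q ^ N *
          (b₁.κ * (θA * V y'' * Q c * Real.exp (-(δ₀ * G.dist y'' c))))
        ≤ ∑ y'' : G.Site, ((Fintype.card G.Site : ℝ) + 1) * M₀ * b₁.κ * θA * Q c * q ^ N * V y'' :=
          Finset.sum_le_sum fun y'' _ => hle y''
      _ = Cst * Q c * q ^ N := by
          rw [hCst, hSV, Finset.mul_sum, Finset.sum_mul, Finset.sum_mul]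
          exact Finset.sum_congr rfl fun y'' _ => by ring
  -- the operator identity: EG′A = EG′₀A + Σ_{m<N} (EG′₀)R′ᵐ(R′A) + (EG′)R′ᴺ(R′A)
  have hident : ∀ (N : ℕ) (μ : F₀), (E ∘ₗ G' ∘ₗ Aop) μ =
      (E ∘ₗ G0 ∘ₗ Aop) μ + (∑ m ∈ Finset.range N, ((E ∘ₗ G0) ∘ₗ (R ^ m)) ∘ₗ (R ∘ₗ Aop)) μ +
        (((E ∘ₗ G') ∘ₗ (R ^ N)) ∘ₗ (R ∘ₗ Aop)) μ := by
    intro N μ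
    have htel := telescope_ring hfix (N + 1)
    have hG : G' (Aop μ) = (∑ n ∈ Finset.range (N + 1), G0 * R ^ n) (Aop μ) + (G' * R ^ (N + 1)) (Aop μ) := by
      conv_lhs => rw [htel]
      rfl
    rw [Finset.sum_range_succ'] at hG
    simp only [LinearMap.comp_apply, LinearMap.sum_apply, LinearMap.add_apply, Module.End.mul_apply, pow_zero,
      Module.End.one_apply] at hG ⊢
    rw [hG, map_add, map_add, map_sum]
    have h1 : ∀ m : ℕ, E (G0 ((R ^ (m + 1)) (Aop μ))) = E (G0 ((R ^ m) (R (Aop μ)))) := fun m => by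
      rw [pow_succ, Module.End.mul_apply]
    have h2 : E (G' ((R ^ (N + 1)) (Aop μ))) = E (G' ((R ^ N) (R (Aop μ)))) := by
      rw [pow_succ, Module.End.mul_apply]
    simp only [h1, h2]
    abel
  -- pointwise, then N → ∞
  intro y' μ hμ y
  set ℓ : ℝ := b₀.loc y' μ with hℓ
  have hℓ0 : 0 ≤ ℓ := b₀.loc_nonneg y' μ
  set C₁ : ℝ := A₂ * W₀ y * Q y' * Real.exp (-((1 - 2 * α) * δ₀ * G.dist y y')) * ℓ with hC₁
  set C₂ : ℝ := A₁ * cα * b₁.κ * θA * C_T * cα * W y * V' y * Q y' * (1 - q)⁻¹ *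
    Real.exp (-((1 - 2 * α) * δ₀ * G.dist y y')) * ℓ with hC₂
  have hgeomC : ∀ N : ℕ, (∑ m ∈ Finset.range N, A₁ * cα * b₁.κ * θA * C_T * cα * W y * V' y * Q y' * q ^ m *
      Real.exp (-((1 - 2 * α) * δ₀ * G.dist y y'))) * ℓ ≤ C₂ := by
    intro N
    have hgeom : ∑ m ∈ Finset.range N, q ^ m ≤ (1 - q)⁻¹ :=
      sum_le_hasSum (Finset.range N) (fun n _ => pow_nonneg hq0 n) (hasSum_geometric_of_lt_one hq0 hsmall)
    have hnn : 0 ≤ A₁ * cα * b₁.κ * θA * C_T * cα * W y * V' y * Q y' *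
        Real.exp (-((1 - 2 * α) * δ₀ * G.dist y y')) * ℓ :=
      mul_nonneg (mul_nonneg (mul_nonneg (mul_nonneg (mul_nonneg (mul_nonneg (mul_nonneg (mul_nonneg
        (mul_nonneg (mul_nonneg hA₁ hc0) b₁.κ_nonneg) hθA) hC) hc0) (hW y)) (hV' y)) (hQ y'))
        (Real.exp_nonneg _)) hℓ0
    calc (∑ m ∈ Finset.range N, A₁ * cα * b₁.κ * θA * C_T * cα * W y * V' y * Q y' * q ^ m *
          Real.exp (-((1 - 2 * α) * δ₀ * G.dist y y'))) * ℓ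
        = (∑ m ∈ Finset.range N, q ^ m) * (A₁ * cα * b₁.κ * θA * C_T * cα * W y * V' y * Q y' *
            Real.exp (-((1 - 2 * α) * δ₀ * G.dist y y')) * ℓ) := by
          rw [Finset.sum_mul, Finset.sum_mul]; exact Finset.sum_congr rfl fun n _ => by ring
      _ ≤ (1 - q)⁻¹ * (A₁ * cα * b₁.κ * θA * C_T * cα * W y * V' y * Q y' *
            Real.exp (-((1 - 2 * α) * δ₀ * G.dist y y')) * ℓ) := mul_le_mul_of_nonneg_right hgeom hnn
      _ = C₂ := by rw [hC₂]; ring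
  have hN : ∀ N : ℕ, b₂.loc y ((E ∘ₗ G' ∘ₗ Aop) μ) ≤ C₁ + C₂ + Cst * Q y' * ℓ * q ^ N := by
    intro N
    rw [hident N μ]
    refine (b₂.loc_add_le y _ _).trans (add_le_add ((b₂.loc_add_le y _ _).trans (add_le_add ?_ ?_)) ?_)
    · have h0 := hzero y' μ hμ y
      simpa [hC₁, mul_assoc] using h0
    · have h1 := hpartial N y' μ hμ y
      exact h1.trans (hgeomC N)
    · have h2 := hrem N y' μ hμ y
      calc b₂.loc y ((((E ∘ₗ G') ∘ₗ (R ^ N)) ∘ₗ (R ∘ₗ Aop)) μ) ≤ Cst * Q y' * q ^ N * ℓ := h2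
        _ = Cst * Q y' * ℓ * q ^ N := by ring
  have hlim : Filter.Tendsto (fun N : ℕ => C₁ + C₂ + Cst * Q y' * ℓ * q ^ N) Filter.atTop
      (nhds (C₁ + C₂ + Cst * Q y' * ℓ * 0)) :=
    ((tendsto_pow_atTop_nhds_zero_of_lt_one hq0 hsmall).const_mul (Cst * Q y' * ℓ)).const_add (C₁ + C₂)
  rw [mul_zero, add_zero] at hlim
  have hfin := ge_of_tendsto' hlim hN
  have hCsum : C₁ + C₂ = (A₂ * W₀ y + A₁ * b₁.κ * θA * C_T * cα ^ 2 * (1 - q)⁻¹ * W y * V' y) * Q y' *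
      Real.exp (-((1 - 2 * α) * δ₀ * G.dist y y')) * ℓ := by
    rw [hC₁, hC₂]; ring
  rw [hCsum] at hfin
  simpa [hqdef, hcα, mul_assoc] using hfin

end TwoSided

/-! ## §3  The same from the per-cube data of (3.87)–(3.89) -/

section Thm37TwoSided

variable {G : B6.Geometry} [DecidableEq G.Site]
variable {F₀ F₁ F₂ : Type} [AddCommGroup F₀] [Module ℝ F₀] [AddCommGroup F₁] [Module ℝ F₁]
  [AddCommGroup F₂] [Module ℝ F₂]

/-- **THEOREM 3.7 ⇒ a TWO-SIDED member EG′A, from the cubes** ((3.87)–(3.90) pp. 409–410 with (3.44)–(3.46)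
p. 398): the legs ET_□ (1_{S_□}(y)A₁W(y)e^{−δ₀d}, `hleg`), the two-sided legs ET_□A (1_{S_□}(y)A₂W₀(y)Q(y′)e^{−δ₀d},
`hlegA`), the (3.89)-terms R_□ in `b₁` (1_{S′_□}(y)θe^{−δ₀d}, `h389`) and R_□A (1_{S′_□}(y)θ_AV(y)Q(y′)e^{−δ₀d}, `h389A`),
the overlap counts N, N′, G′Δ′_a = I and (3.88) summed, the transfer hypothesis for V, Lemma 2.1 at α (d symmetric),
κ₁N′θc₁(α) < 1 and an a-priori constant majorant of EG′ give EG′A the majorant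
(NA₂W₀(y) + N·N′·A₁κ₁θ_AC_Tc₁(α)²(1 − κ₁N′θc₁(α))⁻¹W(y)V′(y))·Q(y′)·e^{−(1−2α)δ₀d(y,y′)}.
[cite: Balaban1985BackgroundPropagators, Thm 3.7 (3.87)–(3.90) pp.409–410, (3.44)–(3.46) p.398; Balaban1984PropagatorsII, Prop. 2.2 p.234] -/
theorem thm37_twoSided (b₀ : BlockNorm G F₀) (b₁ : BlockNorm G F₁) (b₂ : BlockNorm G F₂)
    (E : F₁ →ₗ[ℝ] F₂) (Aop : F₀ →ₗ[ℝ] F₁) (d : ℕ) (δ₀ α θ θA A₁ A₂ C_T N N' M₀ : ℝ)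
    (W W₀ V V' Q : G.Site → ℝ) {ι : Type} [Fintype ι] (S S' : ι → Finset G.Site)
    (Tl Rl : ι → Module.End ℝ F₁) {G' Δ : Module.End ℝ F₁}
    (hθ : 0 ≤ θ) (hθA : 0 ≤ θA) (hA₁ : 0 ≤ A₁) (hA₂ : 0 ≤ A₂) (hC : 0 ≤ C_T) (hN : 0 ≤ N) (hN' : 0 ≤ N')
    (hM₀ : 0 ≤ M₀) (hW : ∀ y, 0 ≤ W y) (hW₀ : ∀ y, 0 ≤ W₀ y) (hV : ∀ y, 0 ≤ V y) (hV' : ∀ y, 0 ≤ V' y)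
    (hQ : ∀ y, 0 ≤ Q y) (hαδ : 0 ≤ α * δ₀) (h2αδ : 0 ≤ (1 - 2 * α) * δ₀)
    (htri : Triangle254 G) (hrefl : ∀ y : G.Site, G.dist y y = 0) (hdnn : ∀ y y' : G.Site, 0 ≤ G.dist y y')
    (hsymm : ∀ a c : G.Site, G.dist a c = G.dist c a) (h261 : Ineq261 d G δ₀ α) (h263 : Ineq263 d G δ₀ α)
    (hsmall : b₁.κ * (N' * θ) * B6.c1 d δ₀ α < 1)
    (hleg : ∀ i, HasMaj b₁ b₂ (E ∘ₗ Tl i)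
      (fun a c => if a ∈ S i then A₁ * W a * Real.exp (-(δ₀ * G.dist a c)) else 0))
    (hlegA : ∀ i, HasMaj b₀ b₂ (E ∘ₗ Tl i ∘ₗ Aop)
      (fun a c => if a ∈ S i then A₂ * W₀ a * Q c * Real.exp (-(δ₀ * G.dist a c)) else 0))
    (hcnt : ∀ a : G.Site, (∑ i, if a ∈ S i then (1 : ℝ) else 0) ≤ N)
    (h389 : ∀ i, HasMaj b₁ b₁ (Rl i)
      (fun a c => if a ∈ S' i then θ * Real.exp (-(δ₀ * G.dist a c)) else 0))
    (h389A : ∀ i, HasMaj b₀ b₁ (Rl i ∘ₗ Aop)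
      (fun a c => if a ∈ S' i then θA * V a * Q c * Real.exp (-(δ₀ * G.dist a c)) else 0))
    (hcnt' : ∀ a : G.Site, (∑ i, if a ∈ S' i then (1 : ℝ) else 0) ≤ N')
    (htransfer : ∀ a y'' : G.Site, V y'' * Real.exp (-(α * δ₀ * G.dist a y'')) ≤ C_T * V' a)
    (hinv : G' * Δ = 1) (h388 : Δ * (∑ i, Tl i) = 1 - ∑ i, Rl i)
    (hap : HasMaj b₁ b₂ (E ∘ₗ G') (fun _ _ => M₀)) :
    HasMaj b₀ b₂ (E ∘ₗ G' ∘ₗ Aop)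
      (fun a c => (N * A₂ * W₀ a + N * A₁ * b₁.κ * (N' * θA) * C_T * B6.c1 d δ₀ α ^ 2 *
          (1 - b₁.κ * (N' * θ) * B6.c1 d δ₀ α)⁻¹ * W a * V' a) * Q c *
        Real.exp (-((1 - 2 * α) * δ₀ * G.dist a c))) := by
  -- EG′₀ and EG′₀A summed over the cubes
  have hleg' : ∀ i, HasMaj b₁ b₂ (E ∘ₗ Tl i)
      (fun a c => (if a ∈ S i then (1 : ℝ) else 0) * (A₁ * W a * Real.exp (-(δ₀ * G.dist a c)))) :=
    fun i => (hleg i).mono fun a c => le_of_eq (by split_ifs <;> simp)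
  have hS₀ := hasMaj_localSum (fun i => E ∘ₗ Tl i) (fun i a => if a ∈ S i then (1 : ℝ) else 0) _ N
    (fun a c => mul_nonneg (mul_nonneg hA₁ (hW a)) (Real.exp_nonneg _)) hleg' hcnt
  have hEG0 : HasMaj b₁ b₂ (E ∘ₗ ∑ i, Tl i) (fun a c => N * A₁ * W a * Real.exp (-(δ₀ * G.dist a c))) := by
    refine (hS₀.congr fun μ => ?_).mono fun a c => le_of_eq (by ring)
    rw [LinearMap.sum_apply, LinearMap.comp_apply, LinearMap.sum_apply, map_sum]
    rfl
  have hlegA' : ∀ i, HasMaj b₀ b₂ (E ∘ₗ Tl i ∘ₗ Aop)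
      (fun a c => (if a ∈ S i then (1 : ℝ) else 0) * (A₂ * W₀ a * Q c * Real.exp (-(δ₀ * G.dist a c)))) :=
    fun i => (hlegA i).mono fun a c => le_of_eq (by split_ifs <;> simp)
  have hSA := hasMaj_localSum (fun i => E ∘ₗ Tl i ∘ₗ Aop) (fun i a => if a ∈ S i then (1 : ℝ) else 0) _ N
    (fun a c => mul_nonneg (mul_nonneg (mul_nonneg hA₂ (hW₀ a)) (hQ c)) (Real.exp_nonneg _)) hlegA' hcnt
  have hEG0A : HasMaj b₀ b₂ (E ∘ₗ (∑ i, Tl i) ∘ₗ Aop)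
      (fun a c => N * A₂ * W₀ a * Q c * Real.exp (-(δ₀ * G.dist a c))) := by
    refine (hSA.congr fun μ => ?_).mono fun a c => le_of_eq (by ring)
    rw [LinearMap.sum_apply, LinearMap.comp_apply, LinearMap.comp_apply, LinearMap.sum_apply, map_sum]
    rfl
  -- R′ and R′A summed
  have h389' : ∀ i, HasMaj b₁ b₁ (Rl i)
      (fun a c => (if a ∈ S' i then (1 : ℝ) else 0) * (θ * Real.exp (-(δ₀ * G.dist a c)))) :=
    fun i => (h389 i).mono fun a c => le_of_eq (by split_ifs <;> simp)
  have hR₀ := hasMaj_localSum Rl (fun i a => if a ∈ S' i then (1 : ℝ) else 0) _ N'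
    (fun a c => mul_nonneg hθ (Real.exp_nonneg _)) h389' hcnt'
  have hR : HasMaj b₁ b₁ (∑ i, Rl i) (fun a c => N' * θ * Real.exp (-(δ₀ * G.dist a c))) :=
    hR₀.mono fun a c => le_of_eq (by ring)
  have h389A' : ∀ i, HasMaj b₀ b₁ (Rl i ∘ₗ Aop)
      (fun a c => (if a ∈ S' i then (1 : ℝ) else 0) * (θA * V a * Q c * Real.exp (-(δ₀ * G.dist a c)))) :=
    fun i => (h389A i).mono fun a c => le_of_eq (by split_ifs <;> simp)
  have hRA₀ := hasMaj_localSum (fun i => Rl i ∘ₗ Aop) (fun i a => if a ∈ S' i then (1 : ℝ) else 0) _ N'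
    (fun a c => mul_nonneg (mul_nonneg (mul_nonneg hθA (hV a)) (hQ c)) (Real.exp_nonneg _)) h389A' hcnt'
  have hRA : HasMaj b₀ b₁ ((∑ i, Rl i) ∘ₗ Aop)
      (fun a c => N' * θA * V a * Q c * Real.exp (-(δ₀ * G.dist a c))) := by
    refine (hRA₀.congr fun μ => ?_).mono fun a c => le_of_eq (by ring)
    rw [LinearMap.sum_apply, LinearMap.comp_apply, LinearMap.sum_apply]
    rfl
  have hfix : G' = (∑ i, Tl i) + G' * ∑ i, Rl i := fixedPoint_of_388 hinv h388
  have hmain := twoSided_series b₀ b₁ b₂ E Aop d δ₀ α (N' * θ) (N' * θA) (N * A₁) (N * A₂) C_T M₀ W W₀ V V' Q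
    (mul_nonneg hN' hθ) (mul_nonneg hN' hθA) (mul_nonneg hN hA₁) (mul_nonneg hN hA₂) hC hM₀ hW hW₀ hV hV' hQ hαδ
    h2αδ htri hrefl hdnn hsymm h261 h263 hsmall hEG0 hEG0A hR hRA htransfer hfix hap
  refine hmain.mono fun a c => le_of_eq ?_
  ring

end Thm37TwoSided

end

end Literature.MathematicalPhysics.QuantumFieldTheory.Balaban1983to89.B9Thm37AllNormsTwoSided
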